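import Literature.MathematicalPhysics.QuantumLattice.HubbardMatsubaraCutoffEmbedding
import HarnessLib

/-!
# The exact Matsubara cutoff embedding `M ≤ M″`, II: the interaction restricts exactly; the covariances are block diagonal

Topic `MathematicalPhysics/QuantumLattice`; continuation of `HubbardMatsubaraCutoffEmbedding.lean` (label
embeddings `emb`, window matrix `E`, restriction `π = cutoffRestrict`, extension `ι = cutoffExtend`).  Here:

* §3 `cutoffRestrict (hubbardInteractionCT L M″ β U K) = hubbardInteractionCT L M β U K` — the quartic Hubbard
  vertex conserves the INTEGER frequency labels (`hubbardInteraction`: "terms whose fourth frequency falls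
  outside the kept ones are absent"), so no monomial has three window labels and one shell label; the
  counterterm vertex `𝒩_K` is diagonal;
* §4 window entries of `C″^K`, `C″^K_{>Λ}` (cutoff `M″`) ARE the entries of `C^K`, `C^K_{>Λ}` (cutoff `M`)
  (`hubbardCovarianceCT_emb`, `hubbardCovAboveCT_emb`; the frequency `ω_n` and the momentum are preserved),
  window–shell entries vanish (`hubbardCovarianceCT_window_shell`: the seed pairs `k ↔ -k` INSIDE the window),
  the compression `E C″^K_{>Λ} Eᵀ = C^K_{>Λ}` (`windowCompress_hubbardCovAboveCT`), and the decomposition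
  `C″^K_{>Λ} = Eᵀ C^K_{>Λ} E + S` (`hubbardCovAboveCT_eq_window_add_shell`) with the SHELL COVARIANCE
  `S = hubbardCovShellCT L h β μ h_s K Λ`, supported on shell × shell where it equals `C″^K_{>Λ}`
  (`hubbardCovShellCT_emb_left/right`, `hubbardCovShellCT_of_not_mem`), antisymmetric.

Everything is proved; no named fact.  Sources and design as in part I (BGM 2006 §2.1 (2.1)–(2.6)
[`BenfattoGiulianiMastropietro2006`]; Salmhofer 1999 §4.2.4 (4.63)–(4.65), §4.2.5 (4.70) [`Salmhofer1999`]); the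
`[cite: …]` tags LOCATE the construct each lemma is about (BGM's interaction (2.6a) and free covariance (2.2)–(2.3)
with the `M` cutoff, Salmhofer's cutoff weight (4.70)) — the lemmas themselves are routine bookkeeping, not named
results of those sources.
-/

noncomputable section

namespace Literature.MathematicalPhysics.QuantumLattice

open GrassmannAlgebra Finset

/-! ### §3 The interaction restricts exactly -/

section Interaction

/-- A sum over a finite type of a function vanishing off the range of an injection is the sum over the
source of the injection. [folklore] -/
private theorem sum_eq_sum_of_injective_of_zero {α γ N : Type*} [Fintype α] [Fintype γ] [DecidableEq γ] [AddCommMonoid N]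
    {e : α → γ} (he : Function.Injective e) (f : γ → N) (hf : ∀ b, b ∉ Set.range e → f b = 0) :
    ∑ b, f b = ∑ a, f (e a) := by
  rw [← Finset.sum_image (f := f) (s := Finset.univ) (g := e) fun x _ y _ hxy => he hxy]
  refine (Finset.sum_subset (Finset.subset_univ _) fun b _ hb => hf b ?_).symm
  rintro ⟨a, rfl⟩
  exact hb (Finset.mem_image_of_mem _ (Finset.mem_univ a))

variable {L : ℕ} [NeZero L] {M M'' : ℕ}

omit [NeZero L] in
/-- `π` of the Hubbard quartic monomial with a shell label vanishes. [cite: BenfattoGiulianiMastropietro2006, §2.1 (2.6a)] -/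
theorem cutoffRestrict_quartic_eq_zero (h : M ≤ M'') {k₁ k₂ k₃ k₄ : FreqMomentum L M''}
    (hk : k₁ ∉ Set.range (FreqMomentum.emb (L := L) h) ∨ k₂ ∉ Set.range (FreqMomentum.emb (L := L) h) ∨
      k₃ ∉ Set.range (FreqMomentum.emb (L := L) h) ∨ k₄ ∉ Set.range (FreqMomentum.emb (L := L) h)) (P : Prop) [Decidable P] :
    cutoffRestrict L h (if P then psiPlus k₁ 0 * psiMinus k₂ 0 * psiPlus k₃ 1 * psiMinus k₄ 1 else 0) = 0 := by
  split_ifs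
  · rw [map_mul, map_mul, map_mul]
    rcases hk with hk | hk | hk | hk
    · rw [cutoffRestrict_psiPlus_of_not_mem h hk, zero_mul, zero_mul, zero_mul]
    · rw [cutoffRestrict_psiMinus_of_not_mem h hk, mul_zero, zero_mul, zero_mul]
    · rw [cutoffRestrict_psiPlus_of_not_mem h hk, mul_zero, zero_mul]
    · rw [cutoffRestrict_psiMinus_of_not_mem h hk, mul_zero]
  · exact map_zero _

/-- **The Hubbard vertex restricts exactly**: `π V″ = V` — the quartic vertex at cutoff `M″` with the
shell fields set to zero is the quartic vertex at cutoff `M` (integer frequency conservation: a monomial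
with three window labels and one shell label does not occur). [cite: BenfattoGiulianiMastropietro2006, §2.1 (2.6a)] -/
theorem cutoffRestrict_hubbardInteraction (h : M ≤ M'') (β U : ℝ) :
    cutoffRestrict L h (hubbardInteraction L M'' β U) = hubbardInteraction L M β U := by
  have hinj := FreqMomentum.emb_injective (L := L) h
  unfold hubbardInteraction
  rw [map_smul]
  congr 1
  simp only [map_sum]
  rw [sum_eq_sum_of_injective_of_zero hinj _ fun k₁ hk₁ => ?_]
  · refine Finset.sum_congr rfl fun k₁ _ => ?_
    rw [sum_eq_sum_of_injective_of_zero hinj _ fun k₂ hk₂ => ?_]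
    · refine Finset.sum_congr rfl fun k₂ _ => ?_
      rw [sum_eq_sum_of_injective_of_zero hinj _ fun k₃ hk₃ => ?_]
      · refine Finset.sum_congr rfl fun k₃ _ => ?_
        rw [sum_eq_sum_of_injective_of_zero hinj _ fun k₄ hk₄ => ?_]
        · refine Finset.sum_congr rfl fun k₄ _ => ?_
          simp only [FreqMomentum.emb_fst, FreqMomentum.emb_snd, matsubaraInt_emb]
          split_ifs
          · rw [map_mul, map_mul, map_mul, cutoffRestrict_psiPlus_emb, cutoffRestrict_psiMinus_emb,
              cutoffRestrict_psiPlus_emb, cutoffRestrict_psiMinus_emb]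
          · exact map_zero _
        · exact cutoffRestrict_quartic_eq_zero h (Or.inr (Or.inr (Or.inr hk₄))) _
      · exact Finset.sum_eq_zero fun k₄ _ => cutoffRestrict_quartic_eq_zero h (Or.inr (Or.inr (Or.inl hk₃))) _
    · exact Finset.sum_eq_zero fun k₃ _ => Finset.sum_eq_zero fun k₄ _ =>
        cutoffRestrict_quartic_eq_zero h (Or.inr (Or.inl hk₂)) _
  · exact Finset.sum_eq_zero fun k₂ _ => Finset.sum_eq_zero fun k₃ _ => Finset.sum_eq_zero fun k₄ _ =>
      cutoffRestrict_quartic_eq_zero h (Or.inl hk₁) _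

/-- **The counterterm vertex restricts exactly**: `π 𝒩″_K = 𝒩_K` (it is diagonal in the label). [cite: BenfattoGiulianiMastropietro2006, §2.1 (2.6a)] -/
theorem cutoffRestrict_counterQuadratic (h : M ≤ M'') (β : ℝ) (K : TrigPolyC4v) :
    cutoffRestrict L h (counterQuadratic L M'' β K) = counterQuadratic L M β K := by
  unfold counterQuadratic
  simp only [map_sum, map_smul, map_mul]
  rw [sum_eq_sum_of_injective_of_zero (FreqMomentum.emb_injective (L := L) h) _ fun k hk => ?_]
  · refine Finset.sum_congr rfl fun k _ => ?_
    simp only [cutoffRestrict_psiPlus_emb, cutoffRestrict_psiMinus_emb, FreqMomentum.emb_snd]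
  · exact Finset.sum_eq_zero fun σ _ => by rw [cutoffRestrict_psiPlus_of_not_mem h hk, zero_mul, smul_zero]

/-- **The interaction in the frame `K` restricts exactly**: `π V″_K = V_K`. [cite: BenfattoGiulianiMastropietro2006, §2.1 (2.6a)] -/
theorem cutoffRestrict_hubbardInteractionCT (h : M ≤ M'') (β U : ℝ) (K : TrigPolyC4v) :
    cutoffRestrict L h (hubbardInteractionCT L M'' β U K) = hubbardInteractionCT L M β U K := by
  rw [hubbardInteractionCT, map_add, cutoffRestrict_hubbardInteraction, cutoffRestrict_counterQuadratic,
    hubbardInteractionCT]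

end Interaction

/-! ### §4 The covariances are block diagonal; the shell covariance -/

section CovarianceEntries

variable {L : ℕ} {M M'' : ℕ} (h : M ≤ M'') (β μ hs : ℝ) (K : TrigPolyC4v)

/-- Window entries of the BCS denominator. [cite: BenfattoGiulianiMastropietro2006, §2.1 (2.2)–(2.3)] -/
theorem nambuDenCT_emb (k : FreqMomentum L M) :
    nambuDenCT L M'' β μ hs K (FreqMomentum.emb h k) = nambuDenCT L M β μ hs K k := by
  simp only [nambuDenCT, FreqMomentum.emb_fst, FreqMomentum.emb_snd, matsubaraFreq_emb]

/-- Window entries of the Nambu propagator. [cite: BenfattoGiulianiMastropietro2006, §2.1 (2.2)–(2.3)] -/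
theorem nambuPropagatorCT_emb (k : FreqMomentum L M) :
    nambuPropagatorCT L M'' β μ hs K (FreqMomentum.emb h k) = nambuPropagatorCT L M β μ hs K k := by
  simp only [nambuPropagatorCT, nambuDenCT_emb, FreqMomentum.emb_fst, FreqMomentum.emb_snd, matsubaraFreq_emb]

/-- Window entries of the Nambu two-point table. [cite: BenfattoGiulianiMastropietro2006, §2.1 (2.2)–(2.3)] -/
theorem nambuTwoPointCT_emb (X Y : HubbardFieldIdx L M) :
    nambuTwoPointCT L M'' β μ hs K (HubbardFieldIdx.emb h X) (HubbardFieldIdx.emb h Y) = nambuTwoPointCT L M β μ hs K X Y := by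
  simp only [nambuTwoPointCT, HubbardFieldIdx.emb_fst_fst, HubbardFieldIdx.emb_fst_snd, HubbardFieldIdx.emb_snd,
    (FreqMomentum.emb_injective h).eq_iff, nambuPropagatorCT_emb]

/-- Window entries of the two-point table. [cite: BenfattoGiulianiMastropietro2006, §2.1 (2.2)–(2.3)] -/
theorem hubbardTwoPointCT_emb (X Y : HubbardFieldIdx L M) :
    hubbardTwoPointCT L M'' β μ hs K (HubbardFieldIdx.emb h X) (HubbardFieldIdx.emb h Y) = hubbardTwoPointCT L M β μ hs K X Y := by
  simp only [hubbardTwoPointCT, toNambu_emb, nambuTwoPointCT_emb]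

/-- **Window entries of the covariance at cutoff `M″` are the entries at cutoff `M`**:
`C″^K (emb X) (emb Y) = C^K X Y`. [cite: BenfattoGiulianiMastropietro2006, §2.1 (2.2)–(2.3)] -/
theorem hubbardCovarianceCT_emb (X Y : HubbardFieldIdx L M) :
    hubbardCovarianceCT L M'' β μ hs K (HubbardFieldIdx.emb h X) (HubbardFieldIdx.emb h Y) = hubbardCovarianceCT L M β μ hs K X Y := by
  simp only [hubbardCovarianceCT, Matrix.of_apply, hubbardTwoPointCT_emb]

/-- The Nambu table vanishes between different frequency–momentum labels. [cite: BenfattoGiulianiMastropietro2006, §2.1 (2.2)–(2.3)] -/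
theorem nambuTwoPointCT_eq_zero_of_ne {N : ℕ} {X Y : (FreqMomentum L N × Fin 2) × Fin 2} (hne : X.1.1 ≠ Y.1.1) :
    nambuTwoPointCT L N β μ hs K X Y = 0 := by
  rw [nambuTwoPointCT, if_neg]
  rintro ⟨-, -, h3⟩
  exact hne h3

/-- The Nambu label of a field is in the window iff the field's momentum label is. [cite: BenfattoGiulianiMastropietro2006, §2.1 (2.2)–(2.3)] -/
theorem toNambu_mem_range_iff (X : HubbardFieldIdx L M'') :
    (toNambu X).1.1 ∈ Set.range (FreqMomentum.emb (L := L) h) ↔ momentumOf L M'' X ∈ Set.range (FreqMomentum.emb (L := L) h) := by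
  unfold toNambu momentumOf
  split_ifs
  · exact Iff.rfl
  · exact FreqMomentum.neg_mem_range_emb_iff h _

/-- **Window–shell entries of the covariance vanish** (the seed pairs `k` with `-k`, inside the window).
[cite: BenfattoGiulianiMastropietro2006, §2.1 (2.2)–(2.3)] -/
theorem hubbardCovarianceCT_window_shell {X Y : HubbardFieldIdx L M''}
    (hX : momentumOf L M'' X ∈ Set.range (FreqMomentum.emb (L := L) h))
    (hY : momentumOf L M'' Y ∉ Set.range (FreqMomentum.emb (L := L) h)) :
    hubbardCovarianceCT L M'' β μ hs K X Y = 0 := by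
  have hX' := (toNambu_mem_range_iff h X).2 hX
  have hY' : (toNambu Y).1.1 ∉ Set.range (FreqMomentum.emb (L := L) h) := fun hh => hY ((toNambu_mem_range_iff h Y).1 hh)
  have hne : (toNambu X).1.1 ≠ (toNambu Y).1.1 := fun he => hY' (he ▸ hX')
  simp only [hubbardCovarianceCT, Matrix.of_apply, hubbardTwoPointCT, nambuTwoPointCT_eq_zero_of_ne β μ hs K hne,
    nambuTwoPointCT_eq_zero_of_ne β μ hs K hne.symm, sub_zero, neg_zero]

/-- Shell–window entries of the covariance vanish. [cite: BenfattoGiulianiMastropietro2006, §2.1 (2.2)–(2.3)] -/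
theorem hubbardCovarianceCT_shell_window {X Y : HubbardFieldIdx L M''}
    (hX : momentumOf L M'' X ∉ Set.range (FreqMomentum.emb (L := L) h))
    (hY : momentumOf L M'' Y ∈ Set.range (FreqMomentum.emb (L := L) h)) :
    hubbardCovarianceCT L M'' β μ hs K X Y = 0 := by
  have hT := congrFun (congrFun (hubbardCovarianceCT_transpose L M'' β μ hs K) X) Y
  rw [Matrix.transpose_apply, Matrix.neg_apply, hubbardCovarianceCT_window_shell h β μ hs K hY hX] at hT
  exact (neg_eq_zero.1 hT.symm)

/-- Window values of the cutoff weight. [cite: Salmhofer1999, §4.2.5 (4.70)] -/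
theorem hubbardCutoffWeightCT_emb (Λ : ℝ) (k : FreqMomentum L M) :
    hubbardCutoffWeightCT L M'' β μ K Λ (FreqMomentum.emb h k) = hubbardCutoffWeightCT L M β μ K Λ k := by
  simp only [hubbardCutoffWeightCT, FreqMomentum.emb_fst, FreqMomentum.emb_snd, matsubaraFreq_emb]

/-- **Window entries of `C″^K_{>Λ}` are the entries of `C^K_{>Λ}`**. [cite: Salmhofer1999, §4.2.5 (4.70)] -/
theorem hubbardCovAboveCT_emb (Λ : ℝ) (X Y : HubbardFieldIdx L M) :
    hubbardCovAboveCT L M'' β μ hs K Λ (HubbardFieldIdx.emb h X) (HubbardFieldIdx.emb h Y) =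
      hubbardCovAboveCT L M β μ hs K Λ X Y := by
  simp only [hubbardCovAboveCT, Matrix.of_apply, momentumOf_emb, hubbardCutoffWeightCT_emb, hubbardCovarianceCT_emb]

/-- Window–shell entries of `C″^K_{>Λ}` vanish. [cite: Salmhofer1999, §4.2.5 (4.70)] -/
theorem hubbardCovAboveCT_window_shell (Λ : ℝ) {X Y : HubbardFieldIdx L M''}
    (hX : momentumOf L M'' X ∈ Set.range (FreqMomentum.emb (L := L) h))
    (hY : momentumOf L M'' Y ∉ Set.range (FreqMomentum.emb (L := L) h)) :
    hubbardCovAboveCT L M'' β μ hs K Λ X Y = 0 := by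
  simp only [hubbardCovAboveCT, Matrix.of_apply, hubbardCovarianceCT_window_shell h β μ hs K hX hY, mul_zero]

/-- Shell–window entries of `C″^K_{>Λ}` vanish. [cite: Salmhofer1999, §4.2.5 (4.70)] -/
theorem hubbardCovAboveCT_shell_window (Λ : ℝ) {X Y : HubbardFieldIdx L M''}
    (hX : momentumOf L M'' X ∉ Set.range (FreqMomentum.emb (L := L) h))
    (hY : momentumOf L M'' Y ∈ Set.range (FreqMomentum.emb (L := L) h)) :
    hubbardCovAboveCT L M'' β μ hs K Λ X Y = 0 := by
  simp only [hubbardCovAboveCT, Matrix.of_apply, hubbardCovarianceCT_shell_window h β μ hs K hX hY, mul_zero]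

end CovarianceEntries

section Shell

variable {L : ℕ} [NeZero L] {M M'' : ℕ} (h : M ≤ M'') (β μ hs : ℝ) (K : TrigPolyC4v)

/-- **Conjugating a covariance at cutoff `M` by the window matrix**: window entries. [cite: BenfattoGiulianiMastropietro2006, §2.1 (2.2)–(2.3)] -/
theorem windowConj_apply_emb (C : Matrix (HubbardFieldIdx L M) (HubbardFieldIdx L M) ℂ) (X Y : HubbardFieldIdx L M) :
    ((windowMatrix L h).transpose * C * windowMatrix L h) (HubbardFieldIdx.emb h X) (HubbardFieldIdx.emb h Y) = C X Y := by
  simp only [Matrix.mul_apply, Matrix.transpose_apply, windowMatrix_apply_emb, boole_mul, mul_boole, Finset.sum_ite_eq',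
    Finset.mem_univ, if_true]

/-- Conjugating by the window matrix: shell rows vanish. [cite: BenfattoGiulianiMastropietro2006, §2.1 (2.2)–(2.3)] -/
theorem windowConj_apply_of_not_mem_left (C : Matrix (HubbardFieldIdx L M) (HubbardFieldIdx L M) ℂ)
    {X'' : HubbardFieldIdx L M''} (hX : X'' ∉ Set.range (HubbardFieldIdx.emb (L := L) h)) (Y'' : HubbardFieldIdx L M'') :
    ((windowMatrix L h).transpose * C * windowMatrix L h) X'' Y'' = 0 := by
  simp only [Matrix.mul_apply, Matrix.transpose_apply, windowMatrix_apply_of_not_mem h _ hX, zero_mul, Finset.sum_const_zero]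

/-- Conjugating by the window matrix: shell columns vanish. [cite: BenfattoGiulianiMastropietro2006, §2.1 (2.2)–(2.3)] -/
theorem windowConj_apply_of_not_mem_right (C : Matrix (HubbardFieldIdx L M) (HubbardFieldIdx L M) ℂ)
    (X'' : HubbardFieldIdx L M'') {Y'' : HubbardFieldIdx L M''} (hY : Y'' ∉ Set.range (HubbardFieldIdx.emb (L := L) h)) :
    ((windowMatrix L h).transpose * C * windowMatrix L h) X'' Y'' = 0 := by
  simp only [Matrix.mul_apply, windowMatrix_apply_of_not_mem h _ hY, mul_zero, Finset.sum_const_zero]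

/-- **Compressing a covariance at cutoff `M″` to the window**: `(E C″ Eᵀ) X Y = C″ (emb X) (emb Y)`. [cite: BenfattoGiulianiMastropietro2006, §2.1 (2.2)–(2.3)] -/
theorem windowCompress_apply (C'' : Matrix (HubbardFieldIdx L M'') (HubbardFieldIdx L M'') ℂ) (X Y : HubbardFieldIdx L M) :
    (windowMatrix L h * C'' * (windowMatrix L h).transpose) X Y = C'' (HubbardFieldIdx.emb h X) (HubbardFieldIdx.emb h Y) := by
  simp only [Matrix.mul_apply, Matrix.transpose_apply, windowMatrix_apply, boole_mul, mul_boole, Finset.sum_ite_eq,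
    Finset.mem_univ, if_true]

/-- **The compression of `C″^K_{>Λ}` to the window is `C^K_{>Λ}`**: `E C″^K_{>Λ} Eᵀ = C^K_{>Λ}`. [cite: Salmhofer1999, §4.2.5 (4.70)] -/
theorem windowCompress_hubbardCovAboveCT (Λ : ℝ) :
    windowMatrix L h * hubbardCovAboveCT L M'' β μ hs K Λ * (windowMatrix L h).transpose = hubbardCovAboveCT L M β μ hs K Λ := by
  ext X Y
  rw [windowCompress_apply, hubbardCovAboveCT_emb]

/-- The compression of `C″^K` to the window is `C^K`. [cite: BenfattoGiulianiMastropietro2006, §2.1 (2.2)–(2.3)] -/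
theorem windowCompress_hubbardCovarianceCT :
    windowMatrix L h * hubbardCovarianceCT L M'' β μ hs K * (windowMatrix L h).transpose = hubbardCovarianceCT L M β μ hs K := by
  ext X Y
  rw [windowCompress_apply, hubbardCovarianceCT_emb]

variable (L)

/-- **The SHELL covariance** `S = C″^K_{>Λ} - Eᵀ C^K_{>Λ} E` at cutoffs `M ≤ M″`: the part of the covariance
above scale `Λ` at cutoff `M″` carried by the shell labels `M ≤ n < M″`, `-M″ ≤ n < -M` (supported on
shell × shell: `hubbardCovShellCT_emb_left/right`, `hubbardCovShellCT_of_not_mem`). [cite: BenfattoGiulianiMastropietro2006, §2.1 (2.2)–(2.3)] -/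
def hubbardCovShellCT (h : M ≤ M'') (β μ hs : ℝ) (K : TrigPolyC4v) (Λ : ℝ) :
    Matrix (HubbardFieldIdx L M'') (HubbardFieldIdx L M'') ℂ :=
  hubbardCovAboveCT L M'' β μ hs K Λ - (windowMatrix L h).transpose * hubbardCovAboveCT L M β μ hs K Λ * windowMatrix L h

variable {L}

/-- **Block decomposition** `C″^K_{>Λ} = Eᵀ C^K_{>Λ} E + S`. [cite: BenfattoGiulianiMastropietro2006, §2.1 (2.2)–(2.3)] -/
theorem hubbardCovAboveCT_eq_window_add_shell (Λ : ℝ) :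
    hubbardCovAboveCT L M'' β μ hs K Λ =
      (windowMatrix L h).transpose * hubbardCovAboveCT L M β μ hs K Λ * windowMatrix L h + hubbardCovShellCT L h β μ hs K Λ := by
  rw [hubbardCovShellCT, add_sub_cancel]

/-- The shell covariance has no window rows. [cite: BenfattoGiulianiMastropietro2006, §2.1 (2.2)–(2.3)] -/
theorem hubbardCovShellCT_emb_left (Λ : ℝ) (X : HubbardFieldIdx L M) (Y'' : HubbardFieldIdx L M'') :
    hubbardCovShellCT L h β μ hs K Λ (HubbardFieldIdx.emb h X) Y'' = 0 := by
  rw [hubbardCovShellCT, Matrix.sub_apply]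
  by_cases hY : Y'' ∈ Set.range (HubbardFieldIdx.emb (L := L) h)
  · obtain ⟨Y, rfl⟩ := hY
    rw [hubbardCovAboveCT_emb, windowConj_apply_emb, sub_self]
  · rw [windowConj_apply_of_not_mem_right h _ _ hY, sub_zero,
      hubbardCovAboveCT_window_shell h β μ hs K Λ ⟨momentumOf L M X, rfl⟩ (by rwa [← HubbardFieldIdx.mem_range_emb_iff])]

/-- The shell covariance has no window columns. [cite: BenfattoGiulianiMastropietro2006, §2.1 (2.2)–(2.3)] -/
theorem hubbardCovShellCT_emb_right (Λ : ℝ) (X'' : HubbardFieldIdx L M'') (Y : HubbardFieldIdx L M) :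
    hubbardCovShellCT L h β μ hs K Λ X'' (HubbardFieldIdx.emb h Y) = 0 := by
  rw [hubbardCovShellCT, Matrix.sub_apply]
  by_cases hX : X'' ∈ Set.range (HubbardFieldIdx.emb (L := L) h)
  · obtain ⟨X, rfl⟩ := hX
    rw [hubbardCovAboveCT_emb, windowConj_apply_emb, sub_self]
  · rw [windowConj_apply_of_not_mem_left h _ hX, sub_zero,
      hubbardCovAboveCT_shell_window h β μ hs K Λ (by rwa [← HubbardFieldIdx.mem_range_emb_iff]) ⟨momentumOf L M Y, rfl⟩]

/-- **On shell × shell the shell covariance IS the covariance above scale `Λ` at cutoff `M″`.** [cite: BenfattoGiulianiMastropietro2006, §2.1 (2.2)–(2.3)] -/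
theorem hubbardCovShellCT_of_not_mem (Λ : ℝ) {X'' Y'' : HubbardFieldIdx L M''}
    (hX : X'' ∉ Set.range (HubbardFieldIdx.emb (L := L) h)) (hY : Y'' ∉ Set.range (HubbardFieldIdx.emb (L := L) h)) :
    hubbardCovShellCT L h β μ hs K Λ X'' Y'' = hubbardCovAboveCT L M'' β μ hs K Λ X'' Y'' := by
  have := hY
  rw [hubbardCovShellCT, Matrix.sub_apply, windowConj_apply_of_not_mem_left h _ hX, sub_zero]

/-- The shell covariance is antisymmetric. [cite: BenfattoGiulianiMastropietro2006, §2.1 (2.2)–(2.3)] -/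
theorem hubbardCovShellCT_transpose (Λ : ℝ) :
    (hubbardCovShellCT L h β μ hs K Λ).transpose = -hubbardCovShellCT L h β μ hs K Λ := by
  rw [hubbardCovShellCT, Matrix.transpose_sub, Matrix.transpose_mul, Matrix.transpose_mul, Matrix.transpose_transpose,
    hubbardCovAboveCT_transpose, hubbardCovAboveCT_transpose, neg_sub', Matrix.neg_mul, Matrix.mul_neg, Matrix.mul_assoc]

end Shell

end Literature.MathematicalPhysics.QuantumLattice
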